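import Mathlib
import HarnessLib

/-!
# The exact `LDLᵀ` semidefiniteness test: symmetric elimination with the zero-pivot rule

Topic `LinearAlgebra/Matrix`; two definitions (the elimination step and the test) and theorems;
no named fact, no instance, no `sorry`.

Deciding EXACTLY whether a symmetric matrix with rational entries is positive semidefinite is
done in practice by symmetric Gaussian elimination (the outer-product `LDLᵀ` / Cholesky
recursion) WITHOUT pivoting, together with the *zero-pivot rule*.  One step on the leading
entry `d = a₁₁` of a symmetric `A = [d cᵀ; c A₂₂]`:

* `d < 0`: `A` is not positive semidefinite (a diagonal entry of a PSD matrix is `≥ 0`,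
  [HornJohnson2013, Obs 7.1.2 and Cor 7.1.5]; [GolubVanLoan2013, Thm 4.2.8 (4.2.14)]);
* `d = 0`: `A` is PSD iff the whole first column (and row) vanishes AND `A₂₂` is PSD — the
  ZERO-PIVOT RULE `a_{ii} = 0 ⇒ A(i,:) = 0, A(:,i) = 0` [GolubVanLoan2013, Thm 4.2.8 (4.2.15)];
  [HornJohnson2013, Observation 7.1.10] (a zero pivot with a nonzero column entry exhibits the
  indefinite `2 × 2` principal submatrix `[0 b; b c]`);
* `d > 0`: `A` is PSD iff the Schur complement `A₂₂ − c cᵀ / d` (the outer-product update of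
  [GolubVanLoan2013, §4.2.8 (4.2.16), Algorithm 4.2.2]) is PSD — the congruence
  [HornJohnson2013, (7.7.5)]: "`H` is positive semidefinite if and only if `A ≻ 0` and
  `C − B^*A⁻¹B ⪰ 0`" for a nonsingular leading block, here `1 × 1` [HornJohnson2013, Thm 7.7.7,
  Thm 7.7.9 (e)].

Recursing on the `(n−1) × (n−1)` matrix produced in the last two cases gives a finite test
`Accepts n A` (no square roots, no pivoting, field operations only — so it runs in exact rational
arithmetic), and the main theorem `accepts_iff_posSemidef` states that for a symmetric `A` the
test accepts iff `A` is positive semidefinite.  As [GolubVanLoan2013, §4.2.8, p. 167] stresses,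
"our entire semidefinite discussion has been an exact arithmetic discussion": the statements here
are over an arbitrary linearly ordered field with trivial involution (`ℚ`, `ℝ`, real algebraic
numbers), for Mathlib's `Matrix.PosSemidef`, with matrices indexed by `Fin n` and the pivots taken
in index order (the index-`0` entry first), exactly as an implementation scans them.

Proof architecture: the completion-of-squares identity
`xᵀ A x = d (x₀ + ℓ(y)/d)² + yᵀ (A₂₂ − c cᵀ/d) y`, `ℓ(y) = cᵀ y`, `x = (x₀, y)` (private
`quadForm_eq_completeSquare`), from which both directions of the `d > 0` step follow (choose
`x₀ = −ℓ(y)/d` for necessity); the `2 × 2` quadratic `τ ↦ a_{ii} τ² + 2 a_{ij} τ + a_{jj} ≥ 0` of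
[GolubVanLoan2013, proof of Thm 4.2.8] for the zero-pivot rule; induction on `n` for the test.

References: [HornJohnson2013] R. A. Horn, C. R. Johnson, *Matrix Analysis*, 2nd ed., CUP 2013,
§7.1 (Obs 7.1.2, Cor 7.1.5, Obs 7.1.10), §7.7 ((7.7.5), Thm 7.7.7, Thm 7.7.9) — held copy
`lit read book:horn2012-matrix-analysis` pp. 530, 607–608; [GolubVanLoan2013] G. H. Golub,
C. F. Van Loan, *Matrix Computations*, 4th ed., 2013, §4.2.8 (Thm 4.2.8, (4.2.12)–(4.2.16),
Algorithm 4.2.2) — held copy `lit read book:golub2012-matrix-computations` pp. 166–167.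
-/

open Matrix Finset BigOperators

namespace Literature.LinearAlgebra.Matrix.PosSemidefElimination

variable {𝕜 : Type*} [Field 𝕜] [LinearOrder 𝕜] [IsStrictOrderedRing 𝕜] [StarRing 𝕜]
  [TrivialStar 𝕜]

section General

variable {n : Type*} [Fintype n] [DecidableEq n] {A : Matrix n n 𝕜}

omit [LinearOrder 𝕜] [IsStrictOrderedRing 𝕜] [DecidableEq n] in
/-- The quadratic form `xᵀ A x` written as an explicit double sum. [folklore] -/
private theorem dotProduct_mulVec_eq_sum (A : Matrix n n 𝕜) (x : n → 𝕜) :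
    star x ⬝ᵥ (A *ᵥ x) = ∑ i, ∑ j, x i * A i j * x j := by
  simp only [dotProduct, mulVec, star_trivial, Finset.mul_sum, mul_assoc]

omit [LinearOrder 𝕜] [IsStrictOrderedRing 𝕜] [Fintype n] [DecidableEq n] in
/-- Over a field with trivial involution, Hermitian means symmetric entrywise. [folklore] -/
private theorem apply_comm (hA : A.IsHermitian) (i j : n) : A j i = A i j := by
  simpa only [star_trivial] using hA.apply i j

omit [IsStrictOrderedRing 𝕜] [DecidableEq n] in
/-- PSD in terms of the explicit double sum (finite index type). [folklore] -/
private theorem posSemidef_iff_sum :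
    A.PosSemidef ↔ A.IsHermitian ∧ ∀ x : n → 𝕜, 0 ≤ ∑ i, ∑ j, x i * A i j * x j := by
  rw [Matrix.posSemidef_iff_dotProduct_mulVec]
  simp only [dotProduct_mulVec_eq_sum]

omit [LinearOrder 𝕜] [IsStrictOrderedRing 𝕜] [StarRing 𝕜] [TrivialStar 𝕜] in
/-- The value of the quadratic form at `τ eᵢ + eⱼ`: `a_{ii} τ² + (a_{ij} + a_{ji}) τ + a_{jj}`
(also when `i = j`). [folklore] -/
private theorem sum_single_add_single (A : Matrix n n 𝕜) (i j : n) (τ : 𝕜) :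
    (∑ a, ∑ b, (Pi.single i τ + Pi.single j 1 : n → 𝕜) a * A a b *
        (Pi.single i τ + Pi.single j 1 : n → 𝕜) b) =
      A i i * τ ^ 2 + (A i j + A j i) * τ + A j j := by
  have key : ∀ a b, (Pi.single i τ + Pi.single j 1 : n → 𝕜) a * A a b *
      (Pi.single i τ + Pi.single j 1 : n → 𝕜) b =
      (if a = i then τ else 0) * A a b * (if b = i then τ else 0) +
      (if a = i then τ else 0) * A a b * (if b = j then 1 else 0) +
      (if a = j then 1 else 0) * A a b * (if b = i then τ else 0) +
      (if a = j then 1 else 0) * A a b * (if b = j then 1 else 0) := by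
    intro a b
    simp only [Pi.add_apply, Pi.single_apply]
    ring
  simp_rw [key, Finset.sum_add_distrib]
  simp only [ite_mul, zero_mul, mul_ite, mul_zero, mul_one, one_mul, Finset.sum_ite_eq',
    Finset.mem_univ, if_true]
  ring

omit [IsStrictOrderedRing 𝕜] in
/-- **A diagonal entry of a positive semidefinite matrix is nonnegative** — so a NEGATIVE PIVOT
refutes semidefiniteness. [cite: HornJohnson2013, Obs 7.1.2 and Cor 7.1.5];
[cite: GolubVanLoan2013, Thm 4.2.8 (4.2.14)] -/
theorem diag_nonneg (hA : A.PosSemidef) (i : n) : 0 ≤ A i i := by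
  have h := (posSemidef_iff_sum.1 hA).2 (Pi.single i 1)
  simpa [Pi.single_apply, Finset.sum_ite_eq', ite_mul, mul_ite] using h

omit [IsStrictOrderedRing 𝕜] in
/-- Negative pivot ⇒ not positive semidefinite. [cite: HornJohnson2013, Obs 7.1.2 and Cor 7.1.5];
[cite: GolubVanLoan2013, Thm 4.2.8 (4.2.14)] -/
theorem not_posSemidef_of_diag_neg {i : n} (hi : A i i < 0) : ¬ A.PosSemidef :=
  fun hA => absurd hi (not_lt.2 (diag_nonneg hA i))

/-- One row entry next to a zero pivot vanishes: `a_{ii} = 0 ⇒ a_{ij} = 0` for a positive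
semidefinite `A` over a linearly ordered field, from
`0 ≤ (τeᵢ + eⱼ)ᵀ A (τeᵢ + eⱼ) = 2 a_{ij} τ + a_{jj}` for all `τ` (no square root is taken, so
the argument runs over `ℚ`). [cite: GolubVanLoan2013, Thm 4.2.8 (4.2.15) and its proof];
[cite: HornJohnson2013, Observation 7.1.10] -/
private theorem row_apply_eq_zero_of_diag_eq_zero (hA : A.PosSemidef) {i : n} (hi : A i i = 0)
    (j : n) : A i j = 0 := by
  have hsymm : A j i = A i j := apply_comm hA.1 i j
  by_cases hij : i = j
  · subst hij; exact hi
  by_contra hne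
  -- evaluate the form at τ eᵢ + eⱼ with τ = -(a_jj + 1) / (2 a_ij)
  set τ : 𝕜 := -(A j j + 1) / (2 * A i j) with hτ
  have h := (posSemidef_iff_sum.1 hA).2 (Pi.single i τ + Pi.single j 1 : n → 𝕜)
  rw [sum_single_add_single A i j τ, hi, hsymm, zero_mul, zero_add] at h
  have h2 : (A i j + A i j) * τ = -(A j j + 1) := by
    rw [hτ]; field_simp; ring
  rw [h2] at h
  linarith

/-- **The zero-pivot rule** over a linearly ordered field (with trivial involution): a zero
diagonal entry `a_{ii} = 0` of a positive semidefinite matrix forces the WHOLE `i`-th row and the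
WHOLE `i`-th column to vanish, `A(i,:) = 0 ∧ A(:,i) = 0`.  The real case (`Matrix n n ℝ`, one
entry at a time) is the landed `Literature.LinearAlgebra.Matrix.apply_eq_zero_of_diag_eq_zero`
(`PosSemidefCrossApproximation`); the present statement is the field-general form needed by the
exact rational test below (`𝕜 = ℚ`), where that real lemma cannot be instantiated.
[cite: GolubVanLoan2013, Thm 4.2.8 (4.2.15)]; [cite: HornJohnson2013, Observation 7.1.10] -/
theorem row_col_eq_zero_of_diag_eq_zero (hA : A.PosSemidef) {i : n} (hi : A i i = 0) :
    (∀ j, A i j = 0) ∧ ∀ j, A j i = 0 :=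
  ⟨fun j => row_apply_eq_zero_of_diag_eq_zero hA hi j,
    fun j => (apply_comm hA.1 i j).trans (row_apply_eq_zero_of_diag_eq_zero hA hi j)⟩

/-- Zero pivot with a nonzero entry in its row or column ⇒ not positive semidefinite (the
`2 × 2` principal submatrix `[0 b; b c]`, `b ≠ 0`, is indefinite).
[cite: HornJohnson2013, Observation 7.1.10]; [cite: GolubVanLoan2013, Thm 4.2.8 (4.2.15)] -/
theorem not_posSemidef_of_diag_eq_zero {i j : n} (hi : A i i = 0) (hij : A j i ≠ 0) :
    ¬ A.PosSemidef :=
  fun hA => hij ((row_col_eq_zero_of_diag_eq_zero hA hi).2 j)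

omit [IsStrictOrderedRing 𝕜] [TrivialStar 𝕜] [Fintype n] [DecidableEq n] in
/-- A principal submatrix of a positive semidefinite matrix is positive semidefinite (Mathlib's
`Matrix.PosSemidef.submatrix`, recorded in the present notation).
[cite: HornJohnson2013, Obs 7.1.2] -/
theorem posSemidef_submatrix {m : Type*} [Fintype m] (hA : A.PosSemidef) (r : m → n) :
    (A.submatrix r r).PosSemidef :=
  hA.submatrix r

end General

/-! ### One elimination step on the leading entry -/

section Step

variable {m : ℕ} {A : Matrix (Fin (m + 1)) (Fin (m + 1)) 𝕜}

/-- **The symmetric elimination step** (outer-product `LDLᵀ` / Cholesky update, the Schur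
complement of the leading `1 × 1` block): `S i j = a_{i+1,j+1} − a_{i+1,0} a_{0,j+1} / a_{00}`.
[cite: GolubVanLoan2013, §4.2.8 (4.2.16) and Algorithm 4.2.2]; [cite: HornJohnson2013, (7.7.5)] -/
def elimStep (A : Matrix (Fin (m + 1)) (Fin (m + 1)) 𝕜) : Matrix (Fin m) (Fin m) 𝕜 :=
  fun i j => A i.succ j.succ - A i.succ 0 * A 0 j.succ / A 0 0

/-- The elimination step of a symmetric matrix is symmetric. [cite: HornJohnson2013, (7.7.5)] -/
theorem isHermitian_elimStep (hA : A.IsHermitian) : (elimStep A).IsHermitian := by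
  refine Matrix.IsHermitian.ext fun i j => ?_
  simp only [star_trivial, elimStep]
  have h1 := hA.apply i.succ j.succ
  have h2 := hA.apply (0 : Fin (m + 1)) j.succ
  have h3 := hA.apply i.succ (0 : Fin (m + 1))
  simp only [star_trivial] at h1 h2 h3
  rw [h1, ← h2, ← h3]
  ring

omit [LinearOrder 𝕜] [IsStrictOrderedRing 𝕜] [StarRing 𝕜] [TrivialStar 𝕜] in
/-- Expansion of the quadratic form along the leading index:
`xᵀ A x = a₀₀ x₀² + x₀ Σⱼ a_{0,j+1} y_j + x₀ Σᵢ y_i a_{i+1,0} + yᵀ A₂₂ y`, `y = tail x`.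
[folklore] -/
private theorem sum_succ_expand (A : Matrix (Fin (m + 1)) (Fin (m + 1)) 𝕜) (x : Fin (m + 1) → 𝕜) :
    (∑ i, ∑ j, x i * A i j * x j) =
      A 0 0 * x 0 ^ 2 + x 0 * (∑ j : Fin m, A 0 j.succ * x j.succ)
        + x 0 * (∑ i : Fin m, x i.succ * A i.succ 0)
        + ∑ i : Fin m, ∑ j : Fin m, x i.succ * A i.succ j.succ * x j.succ := by
  simp only [Fin.sum_univ_succ, Finset.sum_add_distrib, Finset.mul_sum]
  have e1 : ∀ i : Fin m, x i.succ * A i.succ 0 * x 0 = x 0 * (x i.succ * A i.succ 0) :=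
    fun i => by ring
  have e2 : ∀ j : Fin m, x 0 * A 0 j.succ * x j.succ = x 0 * (A 0 j.succ * x j.succ) :=
    fun j => by ring
  simp only [e1, e2]
  ring

omit [StarRing 𝕜] [TrivialStar 𝕜] in
/-- The quadratic form of the elimination step:
`yᵀ S y = yᵀ A₂₂ y − (Σᵢ yᵢ a_{i+1,0}) (Σⱼ a_{0,j+1} yⱼ) / a₀₀`. [folklore] -/
private theorem sum_elimStep (A : Matrix (Fin (m + 1)) (Fin (m + 1)) 𝕜) (y : Fin m → 𝕜) :
    (∑ i, ∑ j, y i * elimStep A i j * y j) =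
      (∑ i, ∑ j, y i * A i.succ j.succ * y j)
        - (∑ i, y i * A i.succ 0) * (∑ j, A 0 j.succ * y j) / A 0 0 := by
  have e : ∀ i j, y i * elimStep A i j * y j =
      y i * A i.succ j.succ * y j - (y i * A i.succ 0) * (A 0 j.succ * y j) / A 0 0 := by
    intro i j; simp only [elimStep]; ring
  simp only [e, Finset.sum_sub_distrib, Finset.sum_div, Finset.sum_mul_sum]

/-- **Completion of the square.** For symmetric `A` with `a₀₀ ≠ 0` and `x = (x₀, y)`:
`xᵀ A x = a₀₀ (x₀ + ℓ/a₀₀)² + yᵀ S y`, `ℓ = Σⱼ a_{0,j+1} yⱼ`, `S = elimStep A`. [folklore] -/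
private theorem quadForm_eq_completeSquare (hA : A.IsHermitian) (hd : A 0 0 ≠ 0)
    (x : Fin (m + 1) → 𝕜) :
    (∑ i, ∑ j, x i * A i j * x j) =
      A 0 0 * (x 0 + (∑ j : Fin m, A 0 j.succ * x j.succ) / A 0 0) ^ 2
        + ∑ i : Fin m, ∑ j : Fin m, x i.succ * elimStep A i j * x j.succ := by
  have hℓ : (∑ i : Fin m, x i.succ * A i.succ 0) = ∑ j : Fin m, A 0 j.succ * x j.succ := by
    refine Finset.sum_congr rfl fun i _ => ?_
    have h := hA.apply i.succ (0 : Fin (m + 1))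
    simp only [star_trivial] at h
    rw [← h]; ring
  rw [sum_succ_expand, sum_elimStep A (fun i => x i.succ), hℓ]
  field_simp
  ring

/-- **Elimination step, positive pivot** (the `1 × 1` case of the Schur-complement criterion
"`H ⪰ 0` iff `A ≻ 0` and `C − B^*A⁻¹B ⪰ 0`"): for symmetric `A` with `a₀₀ > 0`,
`A ⪰ 0 ↔ elimStep A ⪰ 0`. [cite: HornJohnson2013, (7.7.5) and Thm 7.7.7];
[cite: GolubVanLoan2013, §4.2.8 (4.2.16)] -/
theorem posSemidef_iff_elimStep (hA : A.IsHermitian) (hd : 0 < A 0 0) :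
    A.PosSemidef ↔ (elimStep A).PosSemidef := by
  rw [posSemidef_iff_sum, posSemidef_iff_sum]
  constructor
  · rintro ⟨-, h⟩
    refine ⟨isHermitian_elimStep hA, fun y => ?_⟩
    -- choose x₀ := -ℓ(y)/a₀₀ to kill the square
    set ℓ : 𝕜 := ∑ j : Fin m, A 0 j.succ * y j with hℓ
    have hx := h (vecCons (-ℓ / A 0 0) y)
    rw [quadForm_eq_completeSquare hA hd.ne'] at hx
    simp only [cons_val_zero, cons_val_succ] at hx
    have h0 : -ℓ / A 0 0 + ℓ / A 0 0 = 0 := by ring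
    rw [← hℓ, h0] at hx
    simpa using hx
  · rintro ⟨-, h⟩
    refine ⟨hA, fun x => ?_⟩
    rw [quadForm_eq_completeSquare hA hd.ne']
    have h1 : 0 ≤ A 0 0 * (x 0 + (∑ j : Fin m, A 0 j.succ * x j.succ) / A 0 0) ^ 2 :=
      mul_nonneg hd.le (sq_nonneg _)
    have h2 := h (fun i => x i.succ)
    exact add_nonneg h1 h2

omit [IsStrictOrderedRing 𝕜] in
/-- **Elimination step, zero pivot with a vanishing column**: if `a₀₀ = 0` and the leading
column vanishes then (by symmetry so does the leading row and) `A ⪰ 0 ↔ A₂₂ ⪰ 0`, `A₂₂` the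
trailing principal submatrix. [cite: HornJohnson2013, Obs 7.1.2 and Observation 7.1.10];
[cite: GolubVanLoan2013, Thm 4.2.8 (4.2.15)] -/
theorem posSemidef_iff_submatrix_succ (hA : A.IsHermitian) (hcol : ∀ i : Fin m, A i.succ 0 = 0)
    (h0 : A 0 0 = 0) :
    A.PosSemidef ↔ (A.submatrix Fin.succ Fin.succ).PosSemidef := by
  refine ⟨fun h => h.submatrix Fin.succ, fun h => ?_⟩
  rw [posSemidef_iff_sum] at h ⊢
  refine ⟨hA, fun x => ?_⟩
  have hrow : ∀ j : Fin m, A 0 j.succ = 0 := fun j => by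
    have e := hA.apply j.succ (0 : Fin (m + 1))
    simp only [star_trivial] at e
    rw [e]; exact hcol j
  rw [sum_succ_expand]
  simp only [h0, hcol, hrow, zero_mul, mul_zero, Finset.sum_const_zero, add_zero, zero_add]
  exact h.2 (fun i => x i.succ)

/-- **One step of the test decides**: for symmetric `A`,
`A ⪰ 0 ↔ (a₀₀ > 0 ∧ elimStep A ⪰ 0) ∨ (a₀₀ = 0 ∧ A(1:,0) = 0 ∧ A₂₂ ⪰ 0)`.
[cite: GolubVanLoan2013, §4.2.8 (4.2.15)–(4.2.16)]; [cite: HornJohnson2013, (7.7.5) and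
Observation 7.1.10] -/
theorem posSemidef_iff_step (hA : A.IsHermitian) :
    A.PosSemidef ↔
      (0 < A 0 0 ∧ (elimStep A).PosSemidef) ∨
        (A 0 0 = 0 ∧ (∀ i : Fin m, A i.succ 0 = 0) ∧ (A.submatrix Fin.succ Fin.succ).PosSemidef) := by
  rcases lt_trichotomy (A 0 0) 0 with hneg | hzero | hpos
  · constructor
    · exact fun h => (not_posSemidef_of_diag_neg hneg h).elim
    · rintro (⟨hpos, -⟩ | ⟨hz, -, -⟩)
      · exact (lt_asymm hneg hpos).elim
      · exact ((hz ▸ hneg).false).elim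
  · constructor
    · intro h
      refine Or.inr ⟨hzero, fun i => (row_col_eq_zero_of_diag_eq_zero h hzero).2 i.succ, ?_⟩
      exact h.submatrix Fin.succ
    · rintro (⟨hpos, -⟩ | ⟨-, hcol, h⟩)
      · exact ((hzero ▸ hpos).false).elim
      · exact (posSemidef_iff_submatrix_succ hA hcol hzero).2 h
  · rw [posSemidef_iff_elimStep hA hpos]
    constructor
    · exact fun h => Or.inl ⟨hpos, h⟩
    · rintro (⟨-, h⟩ | ⟨hz, -, -⟩)
      · exact h
      · exact ((hz ▸ hpos).false).elim

end Step

/-! ### The recursive test and its correctness -/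

section Test

/-- **The exact no-pivoting `LDLᵀ` semidefiniteness test with the zero-pivot rule** on an
`m × m` matrix, pivots in index order: the empty matrix is accepted; otherwise accept iff
EITHER the leading entry is positive and the elimination step is accepted, OR the leading entry
is zero, the leading column vanishes and the trailing principal submatrix is accepted (a negative
leading entry, or a zero one with a nonzero column entry, rejects).
[cite: GolubVanLoan2013, §4.2.8 (Algorithm 4.2.2 with (4.2.15)–(4.2.16))];
[cite: HornJohnson2013, Observation 7.1.10 and (7.7.5)] -/
def Accepts : (m : ℕ) → Matrix (Fin m) (Fin m) 𝕜 → Prop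
  | 0, _ => True
  | m + 1, A =>
      (0 < A 0 0 ∧ Accepts m (elimStep A)) ∨
        (A 0 0 = 0 ∧ (∀ i : Fin m, A i.succ 0 = 0) ∧ Accepts m (A.submatrix Fin.succ Fin.succ))

omit [IsStrictOrderedRing 𝕜] in
/-- The empty matrix is positive semidefinite. [folklore] -/
private theorem posSemidef_fin_zero (A : Matrix (Fin 0) (Fin 0) 𝕜) : A.PosSemidef := by
  rw [Matrix.posSemidef_iff_dotProduct_mulVec]
  refine ⟨Matrix.IsHermitian.ext fun i _ => i.elim0, fun x => ?_⟩
  simp [dotProduct]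

/-- **Correctness of the exact `LDLᵀ` test.** For a symmetric matrix over a linearly ordered
field (with trivial involution), the no-pivoting elimination test with the zero-pivot rule
accepts if and only if the matrix is positive semidefinite.
[cite: GolubVanLoan2013, §4.2.8 (Thm 4.2.8, (4.2.15)–(4.2.16))]; [cite: HornJohnson2013,
Observation 7.1.10, (7.7.5) and Thm 7.7.7] -/
theorem accepts_iff_posSemidef :
    ∀ {m : ℕ} {A : Matrix (Fin m) (Fin m) 𝕜}, A.IsHermitian → (Accepts m A ↔ A.PosSemidef)
  | 0, A, _ => by simpa [Accepts] using posSemidef_fin_zero A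
  | m + 1, A, hA => by
      rw [posSemidef_iff_step hA, Accepts]
      have h1 : Accepts m (elimStep A) ↔ (elimStep A).PosSemidef :=
        accepts_iff_posSemidef (isHermitian_elimStep hA)
      have h2 : Accepts m (A.submatrix Fin.succ Fin.succ) ↔
          (A.submatrix Fin.succ Fin.succ).PosSemidef :=
        accepts_iff_posSemidef (hA.submatrix Fin.succ)
      rw [h1, h2]

/-- **Soundness** (the direction a certificate checker needs): a symmetric matrix accepted by the
test is positive semidefinite. [cite: GolubVanLoan2013, §4.2.8]; [cite: HornJohnson2013, (7.7.5)
and Observation 7.1.10] -/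
theorem posSemidef_of_accepts {m : ℕ} {A : Matrix (Fin m) (Fin m) 𝕜} (hA : A.IsHermitian)
    (h : Accepts m A) : A.PosSemidef :=
  (accepts_iff_posSemidef hA).1 h

/-- **Completeness**: the test accepts every positive semidefinite matrix (no PSD input is
rejected by the zero-pivot rule). [cite: GolubVanLoan2013, §4.2.8 (4.2.15)];
[cite: HornJohnson2013, Observation 7.1.10] -/
theorem accepts_of_posSemidef {m : ℕ} {A : Matrix (Fin m) (Fin m) 𝕜} (hA : A.PosSemidef) :
    Accepts m A :=
  (accepts_iff_posSemidef hA.1).2 hA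

/-- The symmetric test including the symmetry check: `Aᵀ = A ∧ Accepts`, equivalent to
`Matrix.PosSemidef`. [cite: GolubVanLoan2013, §4.2.8]; [cite: HornJohnson2013, (7.7.5) and
Observation 7.1.10] -/
theorem isHermitian_and_accepts_iff {m : ℕ} (A : Matrix (Fin m) (Fin m) 𝕜) :
    (A.IsHermitian ∧ Accepts m A) ↔ A.PosSemidef :=
  ⟨fun h => posSemidef_of_accepts h.1 h.2, fun h => ⟨h.1, accepts_of_posSemidef h⟩⟩

end Test

/-! ### Instances: the test is stated for rational and for real symmetric matrices -/

example {m : ℕ} (A : Matrix (Fin m) (Fin m) ℚ) (hA : A.IsHermitian) :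
    Accepts m A ↔ A.PosSemidef := accepts_iff_posSemidef hA

example {m : ℕ} (A : Matrix (Fin m) (Fin m) ℝ) (hA : A.IsHermitian) :
    Accepts m A ↔ A.PosSemidef := accepts_iff_posSemidef hA

end Literature.LinearAlgebra.Matrix.PosSemidefElimination
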